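import Mathlib.Analysis.Complex.Schwarz
import Mathlib.Analysis.Complex.AbsMax
import Mathlib.Analysis.Calculus.MeanValue
import Mathlib.Analysis.SpecialFunctions.Complex.Log
import Literature.Analysis.Complex.HolomorphicPrimitives
import HarnessLib

/-!
# Landau–Bloch covering and Koebe's covering theorem with an explicit constant

Trunk support (complex analysis). The one-arm exponent of critical percolation
(`Literature/Probability/Percolation/OneArmHittingPDE.lean`) needs, of Koebe's one-quarter
theorem, only the existence of SOME absolute constant `c > 0` such that the image of the unit
disc under a univalent `f` contains the disc of radius `c |f'(0)|` about `f(0)`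
(`Literature.KoebeCovering c`, `Literature/Analysis/Complex/ConformalRadius.lean`). This weak form —
Koebe's original theorem of 1907 — has an elementary proof from **Bloch's theorem** in Landau's
covering form (J. B. Conway, *Functions of One Complex Variable I*, 2nd ed. (1978), Ch. XII §1:
Lemma 1.1, Lemma 1.2, Thm. 1.4, Cor. 1.7), which we formalise here with unoptimised
constants:

* `Complex.ball_subset_image_closedBall_of_le_norm` — the covering criterion behind Conway's
  Lemma XII.1.1: if `f(0) = 0` and `|f| ≥ δ` on the circle `|z| = r`, then
  `B(0, δ/2) ⊆ f(B̄(0, r))` (maximum modulus applied to `1/(f - w)`, in place of Conway's use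
  of Rouché's theorem, at the cost of the factor `1/2`);
* `Complex.ball_subset_image_of_norm_le` (Conway XII.1.1 with constant `1/16` for `1/6`): if
  `f(0) = 0`, `f'(0) = 1` and `|f| ≤ M` on `𝔻` then `B(0, 1/(16M)) ⊆ f(𝔻)` (via the second-order
  Schwarz lemma `|f(z) - z| ≤ 2M|z|²`, Mathlib's
  `Complex.dist_le_mul_div_pow_of_mapsTo_ball_of_isLittleO`);
* `Complex.ball_subset_image_of_norm_le_of_deriv` (Conway XII.1.2): the rescaled version on
  `B(0, R)` with `|g'(0)| = μ`: `B(0, R²μ²/(16M)) ⊆ g(B(0, R))`;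
* `Complex.exists_ball_subset_image` (**Bloch–Landau covering**, Conway XII.1.4/1.7 in the
  covering form of Exercise XII.1.2, constant `1/128` for `1/72`): if `f` is holomorphic on `𝔻`
  with `f'(0) = 1` then `f(𝔻)` contains some disc of radius `1/128`. Instead of Conway's
  auxiliary function `h(r) = (1 - r) max_{|z| = r} |f'|` we maximise the continuous function
  `(1/2 - |z|) |f'(z)|` on the compact disc `|z| ≤ 1/2`, which yields the same "regular point"
  `a` (`|f'| ≤ 2|f'(a)|` on `B(a, ρ₀)`, `ρ₀ |f'(a)| ≥ 1/4`);
* `Complex.ball_subset_image_of_injOn` (**Koebe covering**, constant `1/(128π)`): for `f`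
  univalent on `𝔻`, `B(f(0), |f'(0)|/(128π)) ⊆ f(𝔻)`. Proof (classical, via the logarithm): if
  `w ∉ f(𝔻)`, a holomorphic logarithm `F` of `1 - (f - f(0))/(w - f(0))` on `𝔻`
  (`Complex.exists_eq_exp_of_forall_isExactOn`, `Literature/Analysis/Complex/
  HolomorphicPrimitives.lean`, with Mathlib's `DifferentiableOn.isExactOn_ball`) takes no two
  values differing by `2πi` (by injectivity of `f`), yet by Bloch–Landau its image contains a
  disc of radius `|F'(0)|/128 = |f'(0)|/(128 |w - f(0)|)`, which must therefore be `≤ π`.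

The sharp constant `1/4` (Bieberbach 1916, via the area theorem) is NOT proved here; it is the
named fact `Literature.Analysis.Complex.KoebeQuarter`.

As in `Hurwitz.lean`, `Montel.lean`, `RiemannMapping.lean` and `HolomorphicPrimitives.lean`,
declarations live in the `Complex` namespace deliberately.

## References

* J. B. Conway, *Functions of One Complex Variable I*, 2nd ed., Springer GTM 11 (1978),
  Ch. XII §1 (Bloch's theorem): Lemmas 1.1–1.3, Thm. 1.4, Cor. 1.7, Exercise 2 [Conway1978].
* G. F. Lawler, *Conformally invariant processes in the plane*, AMS (2005), Thm. 3.17 (Koebe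
  1/4) [Lawler2008].
-/

noncomputable section

open Metric Set Filter Topology Asymptotics

namespace Complex

/-! ### The covering criterion (maximum modulus) -/

/-- **Covering criterion** (the mechanism of Conway's Lemma XII.1.1, with the maximum modulus
principle replacing Rouché's theorem): let `f` be holomorphic on the unit disc with `f(0) = 0`,
`0 < r < 1`, and `|f(z)| ≥ δ` for `|z| = r`. Then every `w` with `|w| < δ/2` is a value of `f`
on `|z| ≤ r`: otherwise `1/(f - w)` would have modulus `1/|w| > 2/δ` at `0` but `< 2/δ` on
`|z| = r`. [cite: Conway1978, Ch. XII Lemma 1.1] -/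
theorem ball_subset_image_closedBall_of_le_norm {f : ℂ → ℂ} {r δ : ℝ}
    (hf : DifferentiableOn ℂ f (ball 0 1)) (hr0 : 0 < r) (hr1 : r < 1) (hf0 : f 0 = 0)
    (hδ : ∀ z : ℂ, ‖z‖ = r → δ ≤ ‖f z‖) : ball (0 : ℂ) (δ / 2) ⊆ f '' closedBall 0 r := by
  intro w hw
  rw [mem_ball_zero_iff] at hw
  by_contra hnot
  have hne : ∀ z ∈ closedBall (0 : ℂ) r, f z - w ≠ 0 := by
    intro z hz h0
    exact hnot ⟨z, hz, sub_eq_zero.1 h0⟩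
  have hw0 : w ≠ 0 := by
    intro h0
    exact hnot ⟨0, mem_closedBall_self hr0.le, by rw [hf0, h0]⟩
  have hsub : closedBall (0 : ℂ) r ⊆ ball 0 1 := closedBall_subset_ball hr1
  -- `φ = 1/(f - w)` on the closed disc
  have hφ : DiffContOnCl ℂ (fun z => (f z - w)⁻¹) (ball 0 r) := by
    refine DifferentiableOn.diffContOnCl ?_
    rw [closure_ball 0 hr0.ne']
    exact ((hf.mono hsub).sub_const w).inv hne
  have hbound : ∀ z ∈ frontier (ball (0 : ℂ) r), ‖(f z - w)⁻¹‖ ≤ (δ - ‖w‖)⁻¹ := by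
    intro z hz
    rw [frontier_ball 0 hr0.ne', mem_sphere_zero_iff_norm] at hz
    have h1 : δ - ‖w‖ ≤ ‖f z - w‖ := by
      have := norm_sub_norm_le (f z) w
      linarith [hδ z hz]
    have h2 : 0 < δ - ‖w‖ := by linarith [norm_nonneg w]
    rw [norm_inv]
    exact inv_anti₀ h2 h1
  have hmax := norm_le_of_forall_mem_frontier_norm_le isBounded_ball hφ hbound
    (subset_closure (mem_ball_self hr0))
  rw [hf0, zero_sub, norm_inv, norm_neg] at hmax
  have h2 : 0 < δ - ‖w‖ := by linarith [norm_nonneg w]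
  have hwpos : 0 < ‖w‖ := norm_pos_iff.2 hw0
  rw [inv_le_inv₀ hwpos h2] at hmax
  linarith

/-! ### Bounded functions (Conway XII.1.1–1.2) -/

/-- **Second-order Schwarz lemma**: if `f` is holomorphic on `𝔻` with `f(0) = 0`, `f'(0) = 1`
and `|f| ≤ M`, then `|f(z) - z| ≤ 2M |z|²` on `𝔻` (apply the Schwarz lemma of order two to
`f(z) - z`, bounded by `M + 1 ≤ 2M`; here `M ≥ 1` by the Schwarz lemma). [folklore] -/
theorem norm_sub_self_le_of_norm_le {f : ℂ → ℂ} {M : ℝ} (hf : DifferentiableOn ℂ f (ball 0 1))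
    (hf0 : f 0 = 0) (hf1 : deriv f 0 = 1) (hM : ∀ z ∈ ball (0 : ℂ) 1, ‖f z‖ ≤ M) {z : ℂ}
    (hz : z ∈ ball (0 : ℂ) 1) : ‖f z - z‖ ≤ 2 * M * ‖z‖ ^ 2 := by
  have hM1 : 1 ≤ M := by
    have := norm_deriv_le_div_of_mapsTo_ball (R₂ := M) hf (fun z hz => by
      rw [mem_closedBall, hf0, dist_zero_right]; exact hM z hz) one_pos
    rwa [hf1, norm_one, div_one] at this
  set G : ℂ → ℂ := fun z => f z - z with hG
  have hGd : DifferentiableOn ℂ G (ball 0 1) := hf.sub differentiableOn_id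
  have hG0 : G 0 = 0 := by simp [hG, hf0]
  have hmaps : MapsTo G (ball 0 1) (closedBall (G 0) (2 * M)) := by
    intro x hx
    rw [mem_closedBall, hG0, dist_zero_right]
    calc ‖G x‖ ≤ ‖f x‖ + ‖x‖ := norm_sub_le _ _
      _ ≤ M + 1 := add_le_add (hM x hx) (mem_ball_zero_iff.1 hx).le
      _ ≤ 2 * M := by linarith
  -- `G - G(0) = o(z)` since `G'(0) = f'(0) - 1 = 0`
  have hderiv : HasDerivAt G 0 0 := by
    have h1 : HasDerivAt f (deriv f 0) 0 :=
      (hf.differentiableAt (ball_mem_nhds 0 one_pos)).hasDerivAt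
    have := h1.sub (hasDerivAt_id 0)
    rw [hf1, sub_self] at this
    exact this
  have hlittle : (fun x => G x - G 0) =o[𝓝 0] fun w => ‖w - 0‖ ^ 1 := by
    have := hasDerivAt_iff_isLittleO.1 hderiv
    simp only [smul_zero, sub_zero] at this
    refine (this.congr_left fun x => by rw [hG0, sub_zero]).trans_isBigO ?_
    refine (isBigO_refl (fun x : ℂ => x) (𝓝 0)).norm_right.trans (isBigO_of_le _ fun x => ?_)
    simp
  have key := dist_le_mul_div_pow_of_mapsTo_ball_of_isLittleO hGd hmaps hlittle hz
  rw [hG0, dist_zero_right, dist_zero_right, div_one] at key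
  simpa [hG] using key

/-- **Conway's Lemma XII.1.1** (constant `1/16` instead of `1/6`): if `f` is holomorphic on
`𝔻` with `f(0) = 0`, `f'(0) = 1` and `|f| ≤ M` on `𝔻`, then `B(0, 1/(16M)) ⊆ f(𝔻)`. On
`|z| = 1/(4M)` we have `|f(z)| ≥ |z| - 2M|z|² = 1/(8M)`, and the covering criterion applies.
[cite: Conway1978, Ch. XII Lemma 1.1] -/
theorem ball_subset_image_of_norm_le {f : ℂ → ℂ} {M : ℝ} (hf : DifferentiableOn ℂ f (ball 0 1))
    (hf0 : f 0 = 0) (hf1 : deriv f 0 = 1) (hM : ∀ z ∈ ball (0 : ℂ) 1, ‖f z‖ ≤ M) :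
    ball (0 : ℂ) (1 / (16 * M)) ⊆ f '' ball 0 1 := by
  have hM1 : 1 ≤ M := by
    have := norm_deriv_le_div_of_mapsTo_ball (R₂ := M) hf (fun z hz => by
      rw [mem_closedBall, hf0, dist_zero_right]; exact hM z hz) one_pos
    rwa [hf1, norm_one, div_one] at this
  have hM0 : 0 < M := by linarith
  set r : ℝ := 1 / (4 * M) with hr
  have hr0 : 0 < r := by positivity
  have hr1 : r < 1 := by
    rw [hr, div_lt_one (by positivity)]; linarith
  have hδ : ∀ z : ℂ, ‖z‖ = r → 1 / (8 * M) ≤ ‖f z‖ := by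
    intro z hz
    have hzb : z ∈ ball (0 : ℂ) 1 := by rw [mem_ball_zero_iff, hz]; exact hr1
    have h1 := norm_sub_self_le_of_norm_le hf hf0 hf1 hM hzb
    have h2 : ‖z‖ - ‖f z - z‖ ≤ ‖f z‖ := by
      have := norm_sub_norm_le z (z - f z)
      rw [sub_sub_cancel, norm_sub_rev] at this
      linarith
    rw [hz] at h1 h2
    have e : r - 2 * M * r ^ 2 = 1 / (8 * M) := by rw [hr]; field_simp; ring
    linarith
  have := ball_subset_image_closedBall_of_le_norm hf hr0 hr1 hf0 hδ
  rw [show 1 / (8 * M) / 2 = 1 / (16 * M) by ring] at this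
  exact this.trans (image_mono (closedBall_subset_ball hr1))

/-- **Conway's Lemma XII.1.2** (constant `1/16` for `1/6`): if `g` is holomorphic on
`B(0, R)` with `g(0) = 0`, `|g'(0)| = μ > 0` and `|g| ≤ M`, then
`B(0, R²μ²/(16M)) ⊆ g(B(0, R))` (apply the previous lemma to `z ↦ g(Rz)/(R g'(0))`, bounded by
`M/(μR)`). [cite: Conway1978, Ch. XII Lemma 1.2] -/
theorem ball_subset_image_of_norm_le_of_deriv {g : ℂ → ℂ} {R M : ℝ} (hR : 0 < R)
    (hg : DifferentiableOn ℂ g (ball 0 R)) (hg0 : g 0 = 0) (hμ : deriv g 0 ≠ 0)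
    (hM : ∀ z ∈ ball (0 : ℂ) R, ‖g z‖ ≤ M) :
    ball (0 : ℂ) (R ^ 2 * ‖deriv g 0‖ ^ 2 / (16 * M)) ⊆ g '' ball 0 R := by
  set c : ℂ := (R : ℂ) * deriv g 0 with hc
  have hR0 : (R : ℂ) ≠ 0 := by exact_mod_cast hR.ne'
  have hc0 : c ≠ 0 := mul_ne_zero hR0 hμ
  have hμ0 : 0 < ‖deriv g 0‖ := norm_pos_iff.2 hμ
  -- the rescaled function
  set f : ℂ → ℂ := fun z => g ((R : ℂ) * z) / c with hf
  have hmaps : ∀ z ∈ ball (0 : ℂ) 1, (R : ℂ) * z ∈ ball (0 : ℂ) R := by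
    intro z hz
    rw [mem_ball_zero_iff] at hz ⊢
    rw [norm_mul, Complex.norm_real, Real.norm_of_nonneg hR.le]
    exact mul_lt_of_lt_one_right hR hz
  have hfd : DifferentiableOn ℂ f (ball 0 1) := by
    refine DifferentiableOn.div_const ?_ c
    exact hg.comp ((differentiable_id.const_mul _).differentiableOn) hmaps
  have hf0 : f 0 = 0 := by simp [hf, hg0]
  have hf1 : deriv f 0 = 1 := by
    have h1 : HasDerivAt g (deriv g 0) ((R : ℂ) * 0) := by
      rw [mul_zero]; exact (hg.differentiableAt (ball_mem_nhds 0 hR)).hasDerivAt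
    have h2 : HasDerivAt (fun z : ℂ => (R : ℂ) * z) (R : ℂ) 0 := by
      simpa using (hasDerivAt_id (0 : ℂ)).const_mul (R : ℂ)
    have h3 : HasDerivAt (fun z => g ((R : ℂ) * z) / c) (deriv g 0 * (R : ℂ) / c) 0 :=
      (h1.comp 0 h2).div_const c
    rw [hf, h3.deriv, hc]
    field_simp
  have hMf : ∀ z ∈ ball (0 : ℂ) 1, ‖f z‖ ≤ M / (R * ‖deriv g 0‖) := by
    intro z hz
    rw [hf]
    simp only [norm_div, hc, norm_mul, Complex.norm_real, Real.norm_of_nonneg hR.le]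
    exact div_le_div_of_nonneg_right (hM _ (hmaps z hz)) (by positivity)
  have key := ball_subset_image_of_norm_le hfd hf0 hf1 hMf
  -- translate back
  intro w hw
  rw [mem_ball_zero_iff] at hw
  have hM0 : 0 < M := by
    have := hM 0 (mem_ball_self hR)
    rw [hg0, norm_zero] at this
    rcases this.eq_or_lt with h | h
    · rw [← h] at hw; simp at hw; linarith [norm_nonneg w]
    · exact h
  have hwc : w / c ∈ ball (0 : ℂ) (1 / (16 * (M / (R * ‖deriv g 0‖)))) := by
    rw [mem_ball_zero_iff, norm_div, hc, norm_mul, Complex.norm_real, Real.norm_of_nonneg hR.le,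
      div_lt_iff₀ (by positivity)]
    have e : 1 / (16 * (M / (R * ‖deriv g 0‖))) * (R * ‖deriv g 0‖) =
        R ^ 2 * ‖deriv g 0‖ ^ 2 / (16 * M) := by
      field_simp
    rw [e]; exact hw
  obtain ⟨z, hz, hzw⟩ := key hwc
  refine ⟨(R : ℂ) * z, hmaps z hz, ?_⟩
  rw [hf] at hzw
  simp only at hzw
  rw [div_eq_div_iff hc0 hc0] at hzw
  exact mul_right_cancel₀ hc0 hzw

/-! ### Bloch–Landau covering (Conway XII.1.4, 1.7, Exercise 2) -/

/-- **Bloch–Landau covering theorem** (Conway XII.1.4 and Cor. 1.7 in the covering form of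
Exercise XII.1.2; constant `1/128`): if `f` is holomorphic on the unit disc with `f'(0) = 1`,
then `f(𝔻)` contains a disc of radius `1/128`. Proof: a maximiser `a` of
`(1/2 - |z|)|f'(z)|` over `|z| ≤ 1/2` satisfies, with `ρ₀ = (1/2 - |a|)/2` and `μ = |f'(a)|`,
`ρ₀ μ ≥ 1/4` and `|f'| ≤ 2μ` on `B(a, ρ₀)`; then `g(z) = f(z + a) - f(a)` is bounded by `2μρ₀`
on `B(0, ρ₀)` and Lemma XII.1.2 gives `B(f(a), ρ₀μ/32) ⊆ f(𝔻)`.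
[cite: Conway1978, Ch. XII Thm. 1.4, Cor. 1.7] -/
theorem exists_ball_subset_image {f : ℂ → ℂ} (hf : DifferentiableOn ℂ f (ball 0 1))
    (hf1 : deriv f 0 = 1) : ∃ p : ℂ, ball p (1 / 128) ⊆ f '' ball 0 1 := by
  -- continuity of `f'` on the closed half disc
  have hK : IsCompact (closedBall (0 : ℂ) (1 / 2)) := isCompact_closedBall 0 _
  have hKsub : closedBall (0 : ℂ) (1 / 2) ⊆ ball 0 1 := closedBall_subset_ball (by norm_num)
  have hderiv_cont : ContinuousOn (deriv f) (ball 0 1) :=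
    (hf.analyticOnNhd isOpen_ball).deriv.continuousOn
  set φ : ℂ → ℝ := fun z => (1 / 2 - ‖z‖) * ‖deriv f z‖ with hφ
  have hφc : ContinuousOn φ (closedBall 0 (1 / 2)) :=
    ((continuous_const.sub continuous_norm).continuousOn).mul
      (hderiv_cont.mono hKsub).norm
  obtain ⟨a, ha, hmax⟩ := hK.exists_isMaxOn ⟨0, mem_closedBall_self (by norm_num)⟩ hφc
  have hφ0 : φ 0 = 1 / 2 := by simp [hφ, hf1]
  have hφa : 1 / 2 ≤ φ a := by rw [← hφ0]; exact hmax (mem_closedBall_self (by norm_num))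
  rw [mem_closedBall, dist_zero_right] at ha
  set μ : ℝ := ‖deriv f a‖ with hμ
  have hμ0 : 0 ≤ μ := norm_nonneg _
  have ha' : ‖a‖ < 1 / 2 := by
    by_contra h
    have : φ a ≤ 0 := mul_nonpos_of_nonpos_of_nonneg (by simp only [not_lt] at h; linarith) hμ0
    linarith
  set ρ₀ : ℝ := (1 / 2 - ‖a‖) / 2 with hρ₀
  have hρ₀0 : 0 < ρ₀ := by rw [hρ₀]; linarith
  have hφa' : φ a = 2 * ρ₀ * μ := by simp only [hφ, hρ₀, hμ]; ring
  have hρμ : 1 / 4 ≤ ρ₀ * μ := by nlinarith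
  have hμpos : 0 < μ := by nlinarith
  -- `B(a, ρ₀) ⊆ 𝔻` and `|f'| ≤ 2μ` there
  have hball : ball a ρ₀ ⊆ ball 0 1 := by
    intro z hz
    rw [mem_ball_zero_iff]
    rw [mem_ball] at hz
    have := norm_le_norm_add_norm_sub' z a
    rw [← dist_eq_norm] at this
    linarith
  have hderiv_le : ∀ z ∈ ball a ρ₀, ‖deriv f z‖ ≤ 2 * μ := by
    intro z hz
    rw [mem_ball, dist_eq_norm] at hz
    have hzn : ‖z‖ < ‖a‖ + ρ₀ := by
      have := norm_le_norm_add_norm_sub' z a; linarith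
    have hzK : z ∈ closedBall (0 : ℂ) (1 / 2) := by
      rw [mem_closedBall, dist_zero_right]; rw [hρ₀] at hzn; linarith
    have hle : φ z ≤ φ a := hmax hzK
    rw [hφa'] at hle
    simp only [hφ] at hle
    have hgap : ρ₀ ≤ 1 / 2 - ‖z‖ := by rw [hρ₀] at hzn ⊢; linarith
    -- `(1/2 - |z|) |f' z| ≤ 2 ρ₀ μ` and `1/2 - |z| ≥ ρ₀`
    by_contra hlt
    push Not at hlt
    have : ρ₀ * (2 * μ) < (1 / 2 - ‖z‖) * ‖deriv f z‖ :=
      calc ρ₀ * (2 * μ) ≤ (1 / 2 - ‖z‖) * (2 * μ) :=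
            mul_le_mul_of_nonneg_right hgap (by positivity)
        _ < (1 / 2 - ‖z‖) * ‖deriv f z‖ :=
            mul_lt_mul_of_pos_left hlt (lt_of_lt_of_le hρ₀0 hgap)
    linarith
  -- the recentered function `g`
  set g : ℂ → ℂ := fun z => f (z + a) - f a with hg
  have hshift : ∀ z ∈ ball (0 : ℂ) ρ₀, z + a ∈ ball a ρ₀ := by
    intro z hz
    rw [mem_ball_zero_iff] at hz
    rwa [mem_ball, dist_eq_norm, add_sub_cancel_right]
  have hgd : DifferentiableOn ℂ g (ball 0 ρ₀) := by
    refine DifferentiableOn.sub_const ?_ (f a)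
    exact (hf.mono hball).comp (differentiableOn_id.add_const a) hshift
  have hg0 : g 0 = 0 := by simp [hg]
  have hgderiv : deriv g 0 = deriv f a := by
    rw [hg, deriv_sub_const, deriv_comp_add_const, zero_add]
  have hgμ : deriv g 0 ≠ 0 := by
    rw [hgderiv]; exact norm_pos_iff.1 (by rw [← hμ]; exact hμpos)
  have hgM : ∀ z ∈ ball (0 : ℂ) ρ₀, ‖g z‖ ≤ 2 * μ * ρ₀ := by
    intro z hz
    have hmv := (convex_ball a ρ₀).norm_image_sub_le_of_norm_deriv_le (f := f) (C := 2 * μ)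
      (fun x hx => hf.differentiableAt (isOpen_ball.mem_nhds (hball hx))) hderiv_le
      (mem_ball_self hρ₀0) (hshift z hz)
    rw [add_sub_cancel_right] at hmv
    rw [mem_ball_zero_iff] at hz
    simp only [hg]
    calc ‖f (z + a) - f a‖ ≤ 2 * μ * ‖z‖ := hmv
      _ ≤ 2 * μ * ρ₀ := by nlinarith
  have key := ball_subset_image_of_norm_le_of_deriv hρ₀0 hgd hg0 hgμ hgM
  rw [hgderiv, ← hμ] at key
  -- `ρ₀² μ² / (16 · 2μρ₀) = ρ₀ μ / 32 ≥ 1/128`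
  have hrad : 1 / 128 ≤ ρ₀ ^ 2 * μ ^ 2 / (16 * (2 * μ * ρ₀)) := by
    rw [show ρ₀ ^ 2 * μ ^ 2 / (16 * (2 * μ * ρ₀)) = ρ₀ * μ / 32 by field_simp; ring]
    linarith
  refine ⟨f a, fun w hw => ?_⟩
  have hw' : w - f a ∈ ball (0 : ℂ) (ρ₀ ^ 2 * μ ^ 2 / (16 * (2 * μ * ρ₀))) := by
    rw [mem_ball_zero_iff]
    rw [mem_ball, dist_eq_norm] at hw
    exact lt_of_lt_of_le hw hrad
  obtain ⟨z, hz, hzw⟩ := key hw'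
  refine ⟨z + a, hball (hshift z hz), ?_⟩
  simp only [hg] at hzw
  exact sub_left_injective hzw

/-! ### Koebe covering with constant `1/(128π)` -/

/-- **Koebe's covering theorem with an explicit (non-sharp) constant**: if `f` is holomorphic
and injective on the unit disc, then `f(𝔻) ⊇ B(f(0), |f'(0)|/(128π))`. Proof (Koebe 1907 /
classical, via Bloch–Landau): if `w ∉ f(𝔻)`, then `k = 1 - (f - f(0))/(w - f(0))` is
zero-free on `𝔻`, hence `k = e^F` with `F` holomorphic, `F(0) = 0`, `F'(0) = -f'(0)/(w - f(0))`;
by injectivity of `f`, no two values of `F` differ by `2πi`, so `F(𝔻)` contains no disc of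
radius `> π`; but by `Complex.exists_ball_subset_image` it contains a disc of radius
`|F'(0)|/128`. Hence `|w - f(0)| ≥ |f'(0)|/(128π)`. The sharp constant `1/4` is Koebe's
one-quarter theorem (Lawler 2005, Thm. 3.17), not proved here.
[cite: Conway1978, Ch. XII Thm. 1.4] [cite: Lawler2008, Thm. 3.17 (p. 62)] -/
theorem ball_subset_image_of_injOn {f : ℂ → ℂ} (hf : DifferentiableOn ℂ f (ball 0 1))
    (hinj : InjOn f (ball 0 1)) :
    ball (f 0) (‖deriv f 0‖ / (128 * Real.pi)) ⊆ f '' ball 0 1 := by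
  intro w hw
  by_contra hnot
  have hπ := Real.pi_pos
  set d : ℂ := deriv f 0 with hd
  set u : ℂ := w - f 0 with hu
  have hu0 : u ≠ 0 := by
    intro h0
    rw [hu, sub_eq_zero] at h0
    exact hnot ⟨0, mem_ball_self one_pos, h0.symm⟩
  have hne : ∀ z ∈ ball (0 : ℂ) 1, f z ≠ w := fun z hz h => hnot ⟨z, hz, h⟩
  -- the zero-free function `k = 1 - (f - f 0)/u` and its logarithm
  set k : ℂ → ℂ := fun z => 1 - (f z - f 0) / u with hk
  have hkd : DifferentiableOn ℂ k (ball 0 1) :=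
    (differentiableOn_const 1).sub ((hf.sub_const (f 0)).div_const u)
  have hk0 : ∀ z ∈ ball (0 : ℂ) 1, k z ≠ 0 := by
    intro z hz h0
    apply hne z hz
    have : (f z - f 0) / u = 1 := by simp only [hk] at h0; linear_combination -h0
    rw [div_eq_one_iff_eq hu0] at this
    rw [hu] at this
    linear_combination this
  obtain ⟨F₀, hF₀d, hF₀⟩ := exists_eq_exp_of_forall_isExactOn isOpen_ball
    (convex_ball (0 : ℂ) 1).isPreconnected (fun g hg => hg.isExactOn_ball) hkd hk0
  -- normalise `F(0) = 0`
  set F : ℂ → ℂ := fun z => F₀ z - F₀ 0 with hF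
  have hk00 : k 0 = 1 := by simp [hk]
  have hexp0 : exp (F₀ 0) = 1 := by rw [← hF₀ 0 (mem_ball_self one_pos), hk00]
  have hFexp : ∀ z ∈ ball (0 : ℂ) 1, exp (F z) = k z := by
    intro z hz
    rw [hF]
    simp only
    rw [exp_sub, hexp0, div_one, hF₀ z hz]
  have hFd : DifferentiableOn ℂ F (ball 0 1) := hF₀d.sub_const _
  have hF0 : F 0 = 0 := by simp [hF]
  -- no two values of `F` differ by `2πi`
  have hsep : ∀ z₁ ∈ ball (0 : ℂ) 1, ∀ z₂ ∈ ball (0 : ℂ) 1,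
      F z₁ - F z₂ ≠ 2 * Real.pi * I := by
    intro z₁ hz₁ z₂ hz₂ heq
    have h1 : exp (F z₁) = exp (F z₂) := by
      rw [show F z₁ = F z₂ + 2 * Real.pi * I by rw [← heq]; ring, exp_add, exp_two_pi_mul_I,
        mul_one]
    rw [hFexp z₁ hz₁, hFexp z₂ hz₂] at h1
    simp only [hk] at h1
    have h2 : f z₁ = f z₂ := by
      have : (f z₁ - f 0) / u = (f z₂ - f 0) / u := by linear_combination -h1
      rw [div_left_inj' hu0] at this
      linear_combination this
    have h3 : z₁ = z₂ := hinj hz₁ hz₂ h2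
    rw [h3, sub_self] at heq
    have : (2 * Real.pi * I : ℂ) ≠ 0 := by
      apply mul_ne_zero (mul_ne_zero two_ne_zero (by exact_mod_cast hπ.ne')) I_ne_zero
    exact this heq.symm
  -- `F'(0) = -d/u`
  have hdk : HasDerivAt k (-(d / u)) 0 := by
    have h1 : HasDerivAt f d 0 := (hf.differentiableAt (ball_mem_nhds 0 one_pos)).hasDerivAt
    have := ((h1.sub_const (f 0)).div_const u).const_sub 1
    simpa [hk] using this
  have hdF : HasDerivAt F (deriv F 0) 0 :=
    (hFd.differentiableAt (ball_mem_nhds 0 one_pos)).hasDerivAt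
  have hderivF : deriv F 0 = -(d / u) := by
    have h1 : HasDerivAt (fun z => exp (F z)) (exp (F 0) * deriv F 0) 0 := hdF.cexp
    rw [hF0, exp_zero, one_mul] at h1
    have h2 : HasDerivAt k (deriv F 0) 0 :=
      h1.congr_of_eventuallyEq (by
        filter_upwards [ball_mem_nhds (0 : ℂ) one_pos] with z hz
        exact (hFexp z hz).symm)
    exact h2.unique hdk
  -- the case `d = 0` is vacuous
  by_cases hd0 : d = 0
  · rw [hd0, norm_zero, zero_div] at hw
    exact absurd (mem_ball.1 hw) (not_lt.2 dist_nonneg)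
  have hc0 : deriv F 0 ≠ 0 := by rw [hderivF]; exact neg_ne_zero.2 (div_ne_zero hd0 hu0)
  -- Bloch–Landau for `H = F / F'(0)`
  set H : ℂ → ℂ := fun z => F z / deriv F 0 with hH
  have hHd : DifferentiableOn ℂ H (ball 0 1) := hFd.div_const _
  have hH1 : deriv H 0 = 1 := by
    rw [hH, deriv_div_const, div_self hc0]
  obtain ⟨p, hp⟩ := exists_ball_subset_image hHd hH1
  -- the disc `B(F'(0) p, |F'(0)|/128)` lies in `F(𝔻)`
  have hcov : ∀ v : ℂ, ‖v - deriv F 0 * p‖ < ‖deriv F 0‖ / 128 →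
      ∃ z ∈ ball (0 : ℂ) 1, F z = v := by
    intro v hv
    have hvc : v / deriv F 0 ∈ ball p (1 / 128) := by
      rw [mem_ball, dist_eq_norm]
      have e : v / deriv F 0 - p = (v - deriv F 0 * p) / deriv F 0 := by field_simp
      rw [e, norm_div, div_lt_iff₀ (norm_pos_iff.2 hc0)]
      calc ‖v - deriv F 0 * p‖ < ‖deriv F 0‖ / 128 := hv
        _ = 1 / 128 * ‖deriv F 0‖ := by ring
    obtain ⟨z, hz, hzv⟩ := hp hvc
    refine ⟨z, hz, ?_⟩
    simp only [hH] at hzv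
    rw [div_eq_div_iff hc0 hc0] at hzv
    exact mul_right_cancel₀ hc0 hzv
  -- its radius exceeds `π`
  have hrad : Real.pi < ‖deriv F 0‖ / 128 := by
    have hu' : ‖u‖ < ‖d‖ / (128 * Real.pi) := by
      rw [mem_ball, dist_eq_norm] at hw; exact hw
    have hupos : 0 < ‖u‖ := norm_pos_iff.2 hu0
    rw [hderivF, norm_neg, norm_div]
    rw [lt_div_iff₀ (by norm_num : (0 : ℝ) < 128), lt_div_iff₀ hupos]
    rw [lt_div_iff₀ (by positivity)] at hu'
    linarith
  obtain ⟨z₁, hz₁, hFz₁⟩ := hcov (deriv F 0 * p + Real.pi * I) (by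
    rw [add_sub_cancel_left, norm_mul, norm_real, Real.norm_of_nonneg hπ.le, norm_I, mul_one]
    exact hrad)
  obtain ⟨z₂, hz₂, hFz₂⟩ := hcov (deriv F 0 * p - Real.pi * I) (by
    rw [sub_sub_cancel_left, norm_neg, norm_mul, norm_real, Real.norm_of_nonneg hπ.le, norm_I,
      mul_one]
    exact hrad)
  exact hsep z₁ hz₁ z₂ hz₂ (by rw [hFz₁, hFz₂]; ring)

end Complex
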